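import Literature.MathematicalPhysics.QuantumFieldTheory.Balaban1983to89.B6BlockDecayHprimeCovV1
import Literature.MathematicalPhysics.QuantumFieldTheory.Balaban1983to89.B6Repr2129Operator

/-!
# `Balaban1983to89.B6BlockDecayK12V1` — T. Bałaban, *Propagators and renormalization transformations for lattice gauge theories. II*,
# Commun. Math. Phys. **96** (1984) 223–250 [Balaban1984PropagatorsII], Prop. 2.5 p. 246: the operators `K₁ = ∂H′_jC^{(j)}_Λ(∂H′_j)*`,
# `K₂ = ∂ΔH′_jC^{(j)}_Λ(∂H′_j)*` and `K₂*` of (2.129) have exponentially decaying BLOCK kernels for the concrete two-scale data `tsV1`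
# at the paper's scaling `c = η⁻¹ = L^j`, uniformly in the volume, `j`, `Λ′` and the weights — file 5 of the two-level decay programme

statement-level skeleton of published theorems with citation tags; proofs where landed; nothing here is a claim about the Yang–Mills mass gap

p. 246: *"All the above considerations imply the following Proposition 2.5. The operator G … has the representation (2.129) and satisfies all the
inequalities (1.110)–(1.114) of the Proposition 1.2 with a positive constant δ₂ instead of δ₀. This constant depends on d and L only."*

WHAT THIS FILE DOES.  §1 a three-factor composition lemma `X ∘ C ∘ Z*` (file 2's `blockBound_comp` twice: two lattice-sum factors, NO fibre or
volume factor); §2 with the factor bounds of file 4 (`…B6BlockDecayHprimeCovV1`: `T₁ = ∂H′_j` `(A₁, κ)`, `T₁*` `(A₁n^{d+1}(d+1), κ)`,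
`T₃ = ∂ΔH′_j` `((d+1)A₃e^{κ}, κ)`, `T₃*`, `C^{(j)}_Λ` `(E/n^{d+1}, δ_C)` at `c = L^j`) and file 1's `K1_eq`/`K2_eq`/`adjoint_K2`:
**`K₁`, `K₂`, `K₂*` have block bounds `Σ_{b₀′ : y(b₀′₋) = y}|K(e_{b₀′})_{b₀}| ≤ C·e^{−δ|y(b₀₋) − y|_T}` with `δ > 0`, `C ≥ 0` depending on `d, L`
ONLY** (`blockBound_K1_scaling`, `blockBound_K2_scaling`, `blockBound_K2adj_scaling`) — the `n^{d+1}` of the column sums of `T₁*`/`T₃*` cancels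
the `n^{−(d+1)}` of `C^{(j)}_Λ`'s entries (the V1 constant `γ₀ = n^{d+1}c₀(8/L²)²` of (2.110)); *"This constant depends on d and L only"*.

DICTIONARY / DIVERGENCES. (1) Carriers, position maps, metric as in files 3–4. (2) Only the paper's scaling `c = L^j` is stated (file 4 has every
`c`). (3) Positive weights only (gen 12's covariance decay is uniform in them). (4) No new definition, no new hypothesis; NOT summit progress.
Unit `lit-balaban-p22` (gen 14), 2026-08-22.
-/

noncomputable section

open scoped InnerProductSpace BigOperators
open Finset

namespace Literature.MathematicalPhysics.QuantumFieldTheory.Balaban1983to89.B6BlockDecayK12V1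

open LatticeFieldCalculus B5SectBStatements B5Eq117TorusCarriers B6SectAOperatorsV1 B6SectCOperators
  B6SectCTwoScaleV1 B6SectCTwoScaleV1Lattice B5Eq118OneStroke
open BalabanImbrieJaffe1984to88.BIJ85AxialPropagator411 (BondSpace)
open B4Sect5Torus (IsPseudoDist SumBound)
open B4TorusKernel (periodConst)
open B4TorusKernel.MultiPeriod (torusSupNorm torusSupNorm_nonneg)
open B4Sect5Proof (latticeConst latticeConst_nonneg)
open B5Hk163Strip (kappaN kappaN_pos)
open B5Kernel166Decay (periodConst_pos)
open B6LowerBound2153Torus (rep)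
open B6Hprime2132Holder (MGHD)
open B6Repr2129Operator (K1_eq K2_eq adjoint_K2)
open B6BlockDecayCalculus (blockBound_comp torusDist_isPseudoDist torusDist_sumBound)
open B6BlockDecayHprimeCovV1 (MGHD_nonneg blockBound_gradHp blockBound_gradHp_adjoint blockBound_gradLapHp blockBound_gradLapHp_adjoint
  blockBound_C_of_entry cov_entry_uniform)

/-! ## §1  Three factors: `X ∘ C ∘ Z*` -/

section Comp3

variable {Y : Type*} {ρ : Y → Y → ℝ} {KY : ℝ → ℝ} {ι κ : Type} [Fintype Y] [DecidableEq Y] [Fintype ι] [DecidableEq ι] [Fintype κ] [DecidableEq κ]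

/-- **composition of three block bounds** `f ∘ g ∘ h` with `f` at rate `a`, `g` at rate `b`, `h` at rate `a`: for `δ₁ ≤ a`, `δ₁ < b` and `δ₂ ≤ δ₁`,
`δ₂ < a` the composite has the block bound `(C_f·(C_gC_hK(b − δ₁))·K(a − δ₂), δ₂)` (file 2's `blockBound_comp` twice; no fibre factors).
[cite: Balaban1984PropagatorsII, Prop. 2.5 p.246 (composition bookkeeping, ours)] -/
theorem blockBound_comp3 (hρ : IsPseudoDist ρ) (hK : SumBound ρ KY) (f : EuclideanSpace ℝ κ →ₗ[ℝ] EuclideanSpace ℝ ι)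
    (g : EuclideanSpace ℝ κ →ₗ[ℝ] EuclideanSpace ℝ κ) (h : EuclideanSpace ℝ ι →ₗ[ℝ] EuclideanSpace ℝ κ) (pι : ι → Y) (pκ : κ → Y)
    {Cf Cg Ch a b δ₁ δ₂ : ℝ} (hCf : 0 ≤ Cf) (hCg : 0 ≤ Cg) (hCh : 0 ≤ Ch) (hKb : 0 ≤ KY (b - δ₁))
    (hδ₁0 : 0 ≤ δ₁) (hδ₁a : δ₁ ≤ a) (hδ₁b : δ₁ < b) (hδ₂0 : 0 ≤ δ₂) (hδ₂₁ : δ₂ ≤ δ₁) (hδ₂a : δ₂ < a)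
    (hf : ∀ (i : ι) (y : Y), ∑ k ∈ univ.filter (fun k => pκ k = y), |f (EuclideanSpace.single k (1 : ℝ)) i| ≤ Cf * Real.exp (-(a * ρ (pι i) y)))
    (hg : ∀ (k : κ) (y : Y), ∑ k' ∈ univ.filter (fun k' => pκ k' = y), |g (EuclideanSpace.single k' (1 : ℝ)) k| ≤ Cg * Real.exp (-(b * ρ (pκ k) y)))
    (hh : ∀ (k : κ) (y : Y), ∑ i ∈ univ.filter (fun i => pι i = y), |h (EuclideanSpace.single i (1 : ℝ)) k| ≤ Ch * Real.exp (-(a * ρ (pκ k) y)))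
    (i : ι) (y : Y) :
    ∑ i' ∈ univ.filter (fun i' => pι i' = y), |(f ∘ₗ g ∘ₗ h) (EuclideanSpace.single i' (1 : ℝ)) i| ≤
      Cf * (Cg * Ch * KY (b - δ₁)) * KY (a - δ₂) * Real.exp (-(δ₂ * ρ (pι i) y)) := by
  have h1 := blockBound_comp hρ hK g h pκ pκ pι hCg hCh hδ₁0 hδ₁a hδ₁b hg hh
  exact blockBound_comp hρ hK f (g ∘ₗ h) pι pκ pι hCf (by positivity) hδ₂0 hδ₂₁ hδ₂a hf h1 i y

end Comp3

/-! ## §2  `K₁`, `K₂`, `K₂*` at the paper's scaling `c = η⁻¹ = L^j`: block bounds uniform in the volume, `j`, `Λ′`, the weights -/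

section Scaling

variable {d L m K : ℕ} {hd : 1 ≤ d + 1} {hL : Odd L ∧ 1 < L} {j : ℕ}

open Classical in
/-- **`K₁ = ∂H′_jC^{(j)}_Λ(∂H′_j)*` HAS AN EXPONENTIALLY DECAYING BLOCK KERNEL, UNIFORMLY** (at `c = L^j`): there are `δ > 0`, `C ≥ 0` depending on
`d, L` only such that for every volume `(m, K)`, every `j + 1 ≤ m + K`, every `Λ′ ⊂ T^{(j+1)}`, all positive weights and all fine bonds `b₀`, unit sites `y`:
`Σ_{b₀′ : y(b₀′₋) = y}|K₁(e_{b₀′})_{b₀}| ≤ C·e^{−δ|y(b₀₋) − y|_T}` — `T₁` `(A₁, κ)`, `C^{(j)}_Λ` `(E/n^{d+1}, δ_C)`, `T₁*` `(A₁n^{d+1}(d+1), κ)`.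
[cite: Balaban1984PropagatorsII, Prop. 2.5 p.246] -/
theorem blockBound_K1_scaling (d L : ℕ) (hd : 1 ≤ d + 1) (hL : Odd L ∧ 1 < L) :
    ∃ δ : ℝ, 0 < δ ∧ ∃ C : ℝ, 0 ≤ C ∧ ∀ (m K : ℕ) (j : ℕ) (hc : ((L : ℝ) ^ j) ≠ 0)
      (_hj : j + 1 ≤ (⟨d + 1, L, m, K, hd, hL⟩ : Params).m + (⟨d + 1, L, m, K, hd, hL⟩ : Params).K)
      (Λ' : Finset (Site (⟨d + 1, L, m, K, hd, hL⟩ : Params) (j + 1))) (w : CIdx j Λ' → ℝ) (_hw : ∀ i, 0 < w i)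
      (b₀ : PBond (⟨d + 1, L, m, K, hd, hL⟩ : Params) 0) (y : Site (⟨d + 1, L, m, K, hd, hL⟩ : Params) j),
      ∑ b₀' ∈ univ.filter (fun b₀' : PBond (⟨d + 1, L, m, K, hd, hL⟩ : Params) 0 => iterBlockOf j b₀'.src = y),
          |(tsV1 hc Λ' w).K1 (EuclideanSpace.single b₀' (1 : ℝ)) b₀| ≤
        C * Real.exp (-(δ * torusSupNorm (Mk (⟨d + 1, L, m, K, hd, hL⟩ : Params) j)
            (rep (Mk (⟨d + 1, L, m, K, hd, hL⟩ : Params) j) (iterBlockOf j b₀.src) - rep (Mk (⟨d + 1, L, m, K, hd, hL⟩ : Params) j) y))) := by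
  obtain ⟨δC, hδC, E, hE, hCov⟩ := cov_entry_uniform d L hd hL
  set κH : ℝ := kappaN (d + 1) / ((d : ℝ) + 1) with hκH
  have hκH0 : 0 < κH := div_pos (kappaN_pos _) (by positivity)
  set δ₁ : ℝ := min (δC / 2) κH with hδ₁
  set δ₂ : ℝ := min (δC / 2) (κH / 2) with hδ₂
  have hδ₁0 : 0 < δ₁ := lt_min (half_pos hδC) hκH0
  have hδ₂0 : 0 < δ₂ := lt_min (half_pos hδC) (half_pos hκH0)
  have hδ₁C : δ₁ < δC := lt_of_le_of_lt (min_le_left _ _) (half_lt_self hδC)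
  have hδ₁H : δ₁ ≤ κH := min_le_right _ _
  have hδ₂₁ : δ₂ ≤ δ₁ := le_min (min_le_left _ _) ((min_le_right _ _).trans (half_le_self hκH0.le))
  have hδ₂H : δ₂ < κH := lt_of_le_of_lt (min_le_right _ _) (half_lt_self hκH0)
  set A₁ : ℝ := MGHD (d + 1) 1 * periodConst (kappaN (d + 1)) d with hA₁
  have hA₁0 : 0 ≤ A₁ := mul_nonneg (MGHD_nonneg _ _) (periodConst_pos (kappaN_pos _) _).le
  set K₁ : ℝ := latticeConst (d + 1) (δC - δ₁) with hK₁
  set K₂ : ℝ := latticeConst (d + 1) (κH - δ₂) with hK₂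
  have hK₁0 : 0 ≤ K₁ := latticeConst_nonneg _ (by linarith)
  have hK₂0 : 0 ≤ K₂ := latticeConst_nonneg _ (by linarith)
  have hL0 : 0 < L := by have := hL.2; omega
  haveI : NeZero L := ⟨by omega⟩
  have hLp : (0 : ℝ) < L := by exact_mod_cast hL0
  set C : ℝ := A₁ * (E * (A₁ * ((d + 1 : ℕ) : ℝ)) * K₁) * K₂ with hC
  have hC0 : 0 ≤ C := by positivity
  refine ⟨δ₂, hδ₂0, C, hC0, ?_⟩
  intro m K j hc hj Λ' w hw b₀ y
  have hj' : j ≤ m + K := Nat.le_of_succ_le hj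
  set n : ℝ := ((L : ℝ) ^ j) ^ (d + 1) with hn
  have hn0 : 0 < n := by positivity
  have hLj : (0 : ℝ) < (L : ℝ) ^ j := by positivity
  have hρ := torusDist_isPseudoDist (Mk (⟨d + 1, L, m, K, hd, hL⟩ : Params) j)
  have hK := torusDist_sumBound (Mk (⟨d + 1, L, m, K, hd, hL⟩ : Params) j)
  have h1 : |(L : ℝ) ^ j| / (L : ℝ) ^ j = 1 := by rw [abs_of_pos hLj, div_self hc]
  have hcast : (((L ^ j) ^ (d + 1) * (d + 1) : ℕ) : ℝ) = n * ((d + 1 : ℕ) : ℝ) := by rw [hn]; push_cast; ring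
  have hθ : ((L : ℝ) ^ j / (L : ℝ) ^ j) ^ 4 * ((L : ℝ) ^ j) ^ (d + 1) = n := by rw [div_self hc, one_pow, one_mul]
  -- the three factor bounds at the scaling
  have hT : ∀ (b₀ : PBond (⟨d + 1, L, m, K, hd, hL⟩ : Params) 0) (y : Site (⟨d + 1, L, m, K, hd, hL⟩ : Params) j),
      ∑ y' ∈ univ.filter (fun y' : Site (⟨d + 1, L, m, K, hd, hL⟩ : Params) j => y' = y),
          |((tsV1 hc Λ' w).grad ∘ₗ (tsV1 hc Λ' w).hP) (EuclideanSpace.single y' (1 : ℝ)) b₀| ≤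
        A₁ * Real.exp (-(κH * torusSupNorm (Mk (⟨d + 1, L, m, K, hd, hL⟩ : Params) j)
          (rep (Mk (⟨d + 1, L, m, K, hd, hL⟩ : Params) j) (iterBlockOf j b₀.src) - rep (Mk (⟨d + 1, L, m, K, hd, hL⟩ : Params) j) y))) := by
    intro b₀ y
    refine (blockBound_gradHp hc hj' Λ' w b₀ y).trans (le_of_eq ?_)
    rw [h1, Nat.cast_one]; ring
  have hTs : ∀ (y' y : Site (⟨d + 1, L, m, K, hd, hL⟩ : Params) j),
      ∑ b₀ ∈ univ.filter (fun b₀ : PBond (⟨d + 1, L, m, K, hd, hL⟩ : Params) 0 => iterBlockOf j b₀.src = y),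
          |LinearMap.adjoint ((tsV1 hc Λ' w).grad ∘ₗ (tsV1 hc Λ' w).hP) (EuclideanSpace.single b₀ (1 : ℝ)) y'| ≤
        A₁ * (n * ((d + 1 : ℕ) : ℝ)) * Real.exp (-(κH * torusSupNorm (Mk (⟨d + 1, L, m, K, hd, hL⟩ : Params) j)
          (rep (Mk (⟨d + 1, L, m, K, hd, hL⟩ : Params) j) y' - rep (Mk (⟨d + 1, L, m, K, hd, hL⟩ : Params) j) y))) := by
    intro y' y
    refine (blockBound_gradHp_adjoint hc hj' Λ' w y' y).trans (le_of_eq ?_)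
    rw [h1, hcast]; ring
  have hCb : ∀ (x y : Site (⟨d + 1, L, m, K, hd, hL⟩ : Params) j),
      ∑ x' ∈ univ.filter (fun x' : Site (⟨d + 1, L, m, K, hd, hL⟩ : Params) j => x' = y), |(tsV1 hc Λ' w).C (EuclideanSpace.single x' (1 : ℝ)) x| ≤
        E / n * Real.exp (-(δC * torusSupNorm (Mk (⟨d + 1, L, m, K, hd, hL⟩ : Params) j)
          (rep (Mk (⟨d + 1, L, m, K, hd, hL⟩ : Params) j) x - rep (Mk (⟨d + 1, L, m, K, hd, hL⟩ : Params) j) y))) := by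
    intro x y
    refine (blockBound_C_of_entry hc Λ' w (E := E / n) (δ := δC) (by positivity) (fun x x' => ?_) x y).trans (le_of_eq ?_)
    · have h := hCov m K ((L : ℝ) ^ j) hc j hj Λ' w hw x x'
      rwa [hθ] at h
    · rw [Nat.cast_one, mul_one]
  rw [K1_eq (isLattice Λ' hc hj hw)]
  have h := blockBound_comp3 hρ hK ((tsV1 hc Λ' w).grad ∘ₗ (tsV1 hc Λ' w).hP) (tsV1 hc Λ' w).C
    (LinearMap.adjoint ((tsV1 hc Λ' w).grad ∘ₗ (tsV1 hc Λ' w).hP))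
    (fun b₀ : PBond (⟨d + 1, L, m, K, hd, hL⟩ : Params) 0 => iterBlockOf j b₀.src) (fun y : Site (⟨d + 1, L, m, K, hd, hL⟩ : Params) j => y)
    hA₁0 (by positivity : 0 ≤ E / n) (by positivity : 0 ≤ A₁ * (n * ((d + 1 : ℕ) : ℝ))) hK₁0
    hδ₁0.le hδ₁H hδ₁C hδ₂0.le hδ₂₁ hδ₂H hT hCb hTs b₀ y
  refine h.trans (le_of_eq ?_)
  rw [hC, hK₁, hK₂]
  field_simp

open Classical in
/-- **`K₂ = ∂ΔH′_jC^{(j)}_Λ(∂H′_j)*` HAS AN EXPONENTIALLY DECAYING BLOCK KERNEL, UNIFORMLY** (at `c = L^j`): `Σ_{b₀′ : y(b₀′₋) = y}|K₂(e_{b₀′})_{b₀}| ≤ C·e^{−δ|y(b₀₋) − y|_T}`,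
`δ > 0`, `C ≥ 0` depending on `d, L` only — `T₃` `((d+1)A₃e^{κ}, κ)`, `C^{(j)}_Λ` `(E/n^{d+1}, δ_C)`, `T₁*` `(A₁n^{d+1}(d+1), κ)`.
[cite: Balaban1984PropagatorsII, Prop. 2.5 p.246] -/
theorem blockBound_K2_scaling (d L : ℕ) (hd : 1 ≤ d + 1) (hL : Odd L ∧ 1 < L) :
    ∃ δ : ℝ, 0 < δ ∧ ∃ C : ℝ, 0 ≤ C ∧ ∀ (m K : ℕ) (j : ℕ) (hc : ((L : ℝ) ^ j) ≠ 0)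
      (_hj : j + 1 ≤ (⟨d + 1, L, m, K, hd, hL⟩ : Params).m + (⟨d + 1, L, m, K, hd, hL⟩ : Params).K)
      (Λ' : Finset (Site (⟨d + 1, L, m, K, hd, hL⟩ : Params) (j + 1))) (w : CIdx j Λ' → ℝ) (_hw : ∀ i, 0 < w i)
      (b₀ : PBond (⟨d + 1, L, m, K, hd, hL⟩ : Params) 0) (y : Site (⟨d + 1, L, m, K, hd, hL⟩ : Params) j),
      ∑ b₀' ∈ univ.filter (fun b₀' : PBond (⟨d + 1, L, m, K, hd, hL⟩ : Params) 0 => iterBlockOf j b₀'.src = y),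
          |(tsV1 hc Λ' w).K2 (EuclideanSpace.single b₀' (1 : ℝ)) b₀| ≤
        C * Real.exp (-(δ * torusSupNorm (Mk (⟨d + 1, L, m, K, hd, hL⟩ : Params) j)
            (rep (Mk (⟨d + 1, L, m, K, hd, hL⟩ : Params) j) (iterBlockOf j b₀.src) - rep (Mk (⟨d + 1, L, m, K, hd, hL⟩ : Params) j) y))) := by
  obtain ⟨δC, hδC, E, hE, hCov⟩ := cov_entry_uniform d L hd hL
  set κH : ℝ := kappaN (d + 1) / ((d : ℝ) + 1) with hκH
  have hκH0 : 0 < κH := div_pos (kappaN_pos _) (by positivity)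
  set δ₁ : ℝ := min (δC / 2) κH with hδ₁
  set δ₂ : ℝ := min (δC / 2) (κH / 2) with hδ₂
  have hδ₁0 : 0 < δ₁ := lt_min (half_pos hδC) hκH0
  have hδ₂0 : 0 < δ₂ := lt_min (half_pos hδC) (half_pos hκH0)
  have hδ₁C : δ₁ < δC := lt_of_le_of_lt (min_le_left _ _) (half_lt_self hδC)
  have hδ₁H : δ₁ ≤ κH := min_le_right _ _
  have hδ₂₁ : δ₂ ≤ δ₁ := le_min (min_le_left _ _) ((min_le_right _ _).trans (half_le_self hκH0.le))
  have hδ₂H : δ₂ < κH := lt_of_le_of_lt (min_le_right _ _) (half_lt_self hκH0)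
  set A₁ : ℝ := MGHD (d + 1) 1 * periodConst (kappaN (d + 1)) d with hA₁
  have hA₁0 : 0 ≤ A₁ := mul_nonneg (MGHD_nonneg _ _) (periodConst_pos (kappaN_pos _) _).le
  set A₃ : ℝ := ((d + 1 : ℕ) : ℝ) * (MGHD (d + 1) 3 * periodConst (kappaN (d + 1)) d) * Real.exp κH with hA₃
  have hA₃0 : 0 ≤ A₃ := by
    have := MGHD_nonneg (d + 1) 3
    have := periodConst_pos (kappaN_pos (d + 1)) d
    positivity
  set K₁ : ℝ := latticeConst (d + 1) (δC - δ₁) with hK₁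
  set K₂ : ℝ := latticeConst (d + 1) (κH - δ₂) with hK₂
  have hK₁0 : 0 ≤ K₁ := latticeConst_nonneg _ (by linarith)
  have hK₂0 : 0 ≤ K₂ := latticeConst_nonneg _ (by linarith)
  have hL0 : 0 < L := by have := hL.2; omega
  haveI : NeZero L := ⟨by omega⟩
  have hLp : (0 : ℝ) < L := by exact_mod_cast hL0
  set C : ℝ := A₃ * (E * (A₁ * ((d + 1 : ℕ) : ℝ)) * K₁) * K₂ with hC
  have hC0 : 0 ≤ C := by positivity
  refine ⟨δ₂, hδ₂0, C, hC0, ?_⟩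
  intro m K j hc hj Λ' w hw b₀ y
  have hj' : j ≤ m + K := Nat.le_of_succ_le hj
  set n : ℝ := ((L : ℝ) ^ j) ^ (d + 1) with hn
  have hn0 : 0 < n := by positivity
  have hLj : (0 : ℝ) < (L : ℝ) ^ j := by positivity
  have hρ := torusDist_isPseudoDist (Mk (⟨d + 1, L, m, K, hd, hL⟩ : Params) j)
  have hK := torusDist_sumBound (Mk (⟨d + 1, L, m, K, hd, hL⟩ : Params) j)
  have h1 : |(L : ℝ) ^ j| / (L : ℝ) ^ j = 1 := by rw [abs_of_pos hLj, div_self hc]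
  have hcast : (((L ^ j) ^ (d + 1) * (d + 1) : ℕ) : ℝ) = n * ((d + 1 : ℕ) : ℝ) := by rw [hn]; push_cast; ring
  have hθ : ((L : ℝ) ^ j / (L : ℝ) ^ j) ^ 4 * ((L : ℝ) ^ j) ^ (d + 1) = n := by rw [div_self hc, one_pow, one_mul]
  have hT : ∀ (b₀ : PBond (⟨d + 1, L, m, K, hd, hL⟩ : Params) 0) (y : Site (⟨d + 1, L, m, K, hd, hL⟩ : Params) j),
      ∑ y' ∈ univ.filter (fun y' : Site (⟨d + 1, L, m, K, hd, hL⟩ : Params) j => y' = y),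
          |((tsV1 hc Λ' w).grad ∘ₗ (tsV1 hc Λ' w).lap ∘ₗ (tsV1 hc Λ' w).hP) (EuclideanSpace.single y' (1 : ℝ)) b₀| ≤
        A₃ * Real.exp (-(κH * torusSupNorm (Mk (⟨d + 1, L, m, K, hd, hL⟩ : Params) j)
          (rep (Mk (⟨d + 1, L, m, K, hd, hL⟩ : Params) j) (iterBlockOf j b₀.src) - rep (Mk (⟨d + 1, L, m, K, hd, hL⟩ : Params) j) y))) := by
    intro b₀ y
    refine (blockBound_gradLapHp hc hj' Λ' w b₀ y).trans (le_of_eq ?_)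
    rw [h1, Nat.cast_one]; ring
  have hTs : ∀ (y' y : Site (⟨d + 1, L, m, K, hd, hL⟩ : Params) j),
      ∑ b₀ ∈ univ.filter (fun b₀ : PBond (⟨d + 1, L, m, K, hd, hL⟩ : Params) 0 => iterBlockOf j b₀.src = y),
          |LinearMap.adjoint ((tsV1 hc Λ' w).grad ∘ₗ (tsV1 hc Λ' w).hP) (EuclideanSpace.single b₀ (1 : ℝ)) y'| ≤
        A₁ * (n * ((d + 1 : ℕ) : ℝ)) * Real.exp (-(κH * torusSupNorm (Mk (⟨d + 1, L, m, K, hd, hL⟩ : Params) j)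
          (rep (Mk (⟨d + 1, L, m, K, hd, hL⟩ : Params) j) y' - rep (Mk (⟨d + 1, L, m, K, hd, hL⟩ : Params) j) y))) := by
    intro y' y
    refine (blockBound_gradHp_adjoint hc hj' Λ' w y' y).trans (le_of_eq ?_)
    rw [h1, hcast]; ring
  have hCb : ∀ (x y : Site (⟨d + 1, L, m, K, hd, hL⟩ : Params) j),
      ∑ x' ∈ univ.filter (fun x' : Site (⟨d + 1, L, m, K, hd, hL⟩ : Params) j => x' = y), |(tsV1 hc Λ' w).C (EuclideanSpace.single x' (1 : ℝ)) x| ≤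
        E / n * Real.exp (-(δC * torusSupNorm (Mk (⟨d + 1, L, m, K, hd, hL⟩ : Params) j)
          (rep (Mk (⟨d + 1, L, m, K, hd, hL⟩ : Params) j) x - rep (Mk (⟨d + 1, L, m, K, hd, hL⟩ : Params) j) y))) := by
    intro x y
    refine (blockBound_C_of_entry hc Λ' w (E := E / n) (δ := δC) (by positivity) (fun x x' => ?_) x y).trans (le_of_eq ?_)
    · have h := hCov m K ((L : ℝ) ^ j) hc j hj Λ' w hw x x'
      rwa [hθ] at h
    · rw [Nat.cast_one, mul_one]
  rw [K2_eq (isLattice Λ' hc hj hw)]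
  have h := blockBound_comp3 hρ hK ((tsV1 hc Λ' w).grad ∘ₗ (tsV1 hc Λ' w).lap ∘ₗ (tsV1 hc Λ' w).hP) (tsV1 hc Λ' w).C
    (LinearMap.adjoint ((tsV1 hc Λ' w).grad ∘ₗ (tsV1 hc Λ' w).hP))
    (fun b₀ : PBond (⟨d + 1, L, m, K, hd, hL⟩ : Params) 0 => iterBlockOf j b₀.src) (fun y : Site (⟨d + 1, L, m, K, hd, hL⟩ : Params) j => y)
    hA₃0 (by positivity : 0 ≤ E / n) (by positivity : 0 ≤ A₁ * (n * ((d + 1 : ℕ) : ℝ))) hK₁0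
    hδ₁0.le hδ₁H hδ₁C hδ₂0.le hδ₂₁ hδ₂H hT hCb hTs b₀ y
  refine h.trans (le_of_eq ?_)
  rw [hC, hK₁, hK₂]
  field_simp

open Classical in
/-- **`K₂* = ∂H′_jC^{(j)}_Λ(∂ΔH′_j)*` HAS AN EXPONENTIALLY DECAYING BLOCK KERNEL, UNIFORMLY** (at `c = L^j`; file 1's `adjoint_K2`):
`Σ_{b₀′ : y(b₀′₋) = y}|K₂*(e_{b₀′})_{b₀}| ≤ C·e^{−δ|y(b₀₋) − y|_T}`, `δ > 0`, `C ≥ 0` depending on `d, L` only — `T₁` `(A₁, κ)`, `C^{(j)}_Λ` `(E/n^{d+1}, δ_C)`,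
`T₃*` `((d+1)A₃e^{κ}n^{d+1}(d+1), κ)`. [cite: Balaban1984PropagatorsII, Prop. 2.5 p.246] -/
theorem blockBound_K2adj_scaling (d L : ℕ) (hd : 1 ≤ d + 1) (hL : Odd L ∧ 1 < L) :
    ∃ δ : ℝ, 0 < δ ∧ ∃ C : ℝ, 0 ≤ C ∧ ∀ (m K : ℕ) (j : ℕ) (hc : ((L : ℝ) ^ j) ≠ 0)
      (_hj : j + 1 ≤ (⟨d + 1, L, m, K, hd, hL⟩ : Params).m + (⟨d + 1, L, m, K, hd, hL⟩ : Params).K)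
      (Λ' : Finset (Site (⟨d + 1, L, m, K, hd, hL⟩ : Params) (j + 1))) (w : CIdx j Λ' → ℝ) (_hw : ∀ i, 0 < w i)
      (b₀ : PBond (⟨d + 1, L, m, K, hd, hL⟩ : Params) 0) (y : Site (⟨d + 1, L, m, K, hd, hL⟩ : Params) j),
      ∑ b₀' ∈ univ.filter (fun b₀' : PBond (⟨d + 1, L, m, K, hd, hL⟩ : Params) 0 => iterBlockOf j b₀'.src = y),
          |LinearMap.adjoint (tsV1 hc Λ' w).K2 (EuclideanSpace.single b₀' (1 : ℝ)) b₀| ≤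
        C * Real.exp (-(δ * torusSupNorm (Mk (⟨d + 1, L, m, K, hd, hL⟩ : Params) j)
            (rep (Mk (⟨d + 1, L, m, K, hd, hL⟩ : Params) j) (iterBlockOf j b₀.src) - rep (Mk (⟨d + 1, L, m, K, hd, hL⟩ : Params) j) y))) := by
  obtain ⟨δC, hδC, E, hE, hCov⟩ := cov_entry_uniform d L hd hL
  set κH : ℝ := kappaN (d + 1) / ((d : ℝ) + 1) with hκH
  have hκH0 : 0 < κH := div_pos (kappaN_pos _) (by positivity)
  set δ₁ : ℝ := min (δC / 2) κH with hδ₁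
  set δ₂ : ℝ := min (δC / 2) (κH / 2) with hδ₂
  have hδ₁0 : 0 < δ₁ := lt_min (half_pos hδC) hκH0
  have hδ₂0 : 0 < δ₂ := lt_min (half_pos hδC) (half_pos hκH0)
  have hδ₁C : δ₁ < δC := lt_of_le_of_lt (min_le_left _ _) (half_lt_self hδC)
  have hδ₁H : δ₁ ≤ κH := min_le_right _ _
  have hδ₂₁ : δ₂ ≤ δ₁ := le_min (min_le_left _ _) ((min_le_right _ _).trans (half_le_self hκH0.le))
  have hδ₂H : δ₂ < κH := lt_of_le_of_lt (min_le_right _ _) (half_lt_self hκH0)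
  set A₁ : ℝ := MGHD (d + 1) 1 * periodConst (kappaN (d + 1)) d with hA₁
  have hA₁0 : 0 ≤ A₁ := mul_nonneg (MGHD_nonneg _ _) (periodConst_pos (kappaN_pos _) _).le
  set A₃ : ℝ := ((d + 1 : ℕ) : ℝ) * (MGHD (d + 1) 3 * periodConst (kappaN (d + 1)) d) * Real.exp κH with hA₃
  have hA₃0 : 0 ≤ A₃ := by
    have := MGHD_nonneg (d + 1) 3
    have := periodConst_pos (kappaN_pos (d + 1)) d
    positivity
  set K₁ : ℝ := latticeConst (d + 1) (δC - δ₁) with hK₁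
  set K₂ : ℝ := latticeConst (d + 1) (κH - δ₂) with hK₂
  have hK₁0 : 0 ≤ K₁ := latticeConst_nonneg _ (by linarith)
  have hK₂0 : 0 ≤ K₂ := latticeConst_nonneg _ (by linarith)
  have hL0 : 0 < L := by have := hL.2; omega
  haveI : NeZero L := ⟨by omega⟩
  have hLp : (0 : ℝ) < L := by exact_mod_cast hL0
  set C : ℝ := A₁ * (E * (A₃ * ((d + 1 : ℕ) : ℝ)) * K₁) * K₂ with hC
  have hC0 : 0 ≤ C := by positivity
  refine ⟨δ₂, hδ₂0, C, hC0, ?_⟩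
  intro m K j hc hj Λ' w hw b₀ y
  have hj' : j ≤ m + K := Nat.le_of_succ_le hj
  set n : ℝ := ((L : ℝ) ^ j) ^ (d + 1) with hn
  have hn0 : 0 < n := by positivity
  have hLj : (0 : ℝ) < (L : ℝ) ^ j := by positivity
  have hρ := torusDist_isPseudoDist (Mk (⟨d + 1, L, m, K, hd, hL⟩ : Params) j)
  have hK := torusDist_sumBound (Mk (⟨d + 1, L, m, K, hd, hL⟩ : Params) j)
  have h1 : |(L : ℝ) ^ j| / (L : ℝ) ^ j = 1 := by rw [abs_of_pos hLj, div_self hc]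
  have hcast : (((L ^ j) ^ (d + 1) * (d + 1) : ℕ) : ℝ) = n * ((d + 1 : ℕ) : ℝ) := by rw [hn]; push_cast; ring
  have hθ : ((L : ℝ) ^ j / (L : ℝ) ^ j) ^ 4 * ((L : ℝ) ^ j) ^ (d + 1) = n := by rw [div_self hc, one_pow, one_mul]
  have hT : ∀ (b₀ : PBond (⟨d + 1, L, m, K, hd, hL⟩ : Params) 0) (y : Site (⟨d + 1, L, m, K, hd, hL⟩ : Params) j),
      ∑ y' ∈ univ.filter (fun y' : Site (⟨d + 1, L, m, K, hd, hL⟩ : Params) j => y' = y),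
          |((tsV1 hc Λ' w).grad ∘ₗ (tsV1 hc Λ' w).hP) (EuclideanSpace.single y' (1 : ℝ)) b₀| ≤
        A₁ * Real.exp (-(κH * torusSupNorm (Mk (⟨d + 1, L, m, K, hd, hL⟩ : Params) j)
          (rep (Mk (⟨d + 1, L, m, K, hd, hL⟩ : Params) j) (iterBlockOf j b₀.src) - rep (Mk (⟨d + 1, L, m, K, hd, hL⟩ : Params) j) y))) := by
    intro b₀ y
    refine (blockBound_gradHp hc hj' Λ' w b₀ y).trans (le_of_eq ?_)
    rw [h1, Nat.cast_one]; ring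
  have hTs : ∀ (y' y : Site (⟨d + 1, L, m, K, hd, hL⟩ : Params) j),
      ∑ b₀ ∈ univ.filter (fun b₀ : PBond (⟨d + 1, L, m, K, hd, hL⟩ : Params) 0 => iterBlockOf j b₀.src = y),
          |LinearMap.adjoint ((tsV1 hc Λ' w).grad ∘ₗ (tsV1 hc Λ' w).lap ∘ₗ (tsV1 hc Λ' w).hP) (EuclideanSpace.single b₀ (1 : ℝ)) y'| ≤
        A₃ * (n * ((d + 1 : ℕ) : ℝ)) * Real.exp (-(κH * torusSupNorm (Mk (⟨d + 1, L, m, K, hd, hL⟩ : Params) j)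
          (rep (Mk (⟨d + 1, L, m, K, hd, hL⟩ : Params) j) y' - rep (Mk (⟨d + 1, L, m, K, hd, hL⟩ : Params) j) y))) := by
    intro y' y
    refine (blockBound_gradLapHp_adjoint hc hj' Λ' w y' y).trans (le_of_eq ?_)
    rw [h1, hcast]; ring
  have hCb : ∀ (x y : Site (⟨d + 1, L, m, K, hd, hL⟩ : Params) j),
      ∑ x' ∈ univ.filter (fun x' : Site (⟨d + 1, L, m, K, hd, hL⟩ : Params) j => x' = y), |(tsV1 hc Λ' w).C (EuclideanSpace.single x' (1 : ℝ)) x| ≤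
        E / n * Real.exp (-(δC * torusSupNorm (Mk (⟨d + 1, L, m, K, hd, hL⟩ : Params) j)
          (rep (Mk (⟨d + 1, L, m, K, hd, hL⟩ : Params) j) x - rep (Mk (⟨d + 1, L, m, K, hd, hL⟩ : Params) j) y))) := by
    intro x y
    refine (blockBound_C_of_entry hc Λ' w (E := E / n) (δ := δC) (by positivity) (fun x x' => ?_) x y).trans (le_of_eq ?_)
    · have h := hCov m K ((L : ℝ) ^ j) hc j hj Λ' w hw x x'
      rwa [hθ] at h
    · rw [Nat.cast_one, mul_one]
  rw [adjoint_K2 (isLattice Λ' hc hj hw) (positive Λ' hc hj w)]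
  have h := blockBound_comp3 hρ hK ((tsV1 hc Λ' w).grad ∘ₗ (tsV1 hc Λ' w).hP) (tsV1 hc Λ' w).C
    (LinearMap.adjoint ((tsV1 hc Λ' w).grad ∘ₗ (tsV1 hc Λ' w).lap ∘ₗ (tsV1 hc Λ' w).hP))
    (fun b₀ : PBond (⟨d + 1, L, m, K, hd, hL⟩ : Params) 0 => iterBlockOf j b₀.src) (fun y : Site (⟨d + 1, L, m, K, hd, hL⟩ : Params) j => y)
    hA₁0 (by positivity : 0 ≤ E / n) (by positivity : 0 ≤ A₃ * (n * ((d + 1 : ℕ) : ℝ))) hK₁0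
    hδ₁0.le hδ₁H hδ₁C hδ₂0.le hδ₂₁ hδ₂H hT hCb hTs b₀ y
  refine h.trans (le_of_eq ?_)
  rw [hC, hK₁, hK₂]
  field_simp

end Scaling

end Literature.MathematicalPhysics.QuantumFieldTheory.Balaban1983to89.B6BlockDecayK12V1

end
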